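import Literature.NumberTheory.Automorphic.Liu2021.Prop413AsPrinted
import Mathlib.RepresentationTheory.Intertwining
import HarnessLib

/-!
# [Liu 2021] proof of Prop. 4.13, last sentence (l. 2145) AS PRINTED — multiplicity one, MODULE form:
# `dim_ℂ Hom_{ℂ[𝔾(𝔸_F^∞)]}(ω(μ,ε,χ), H¹_{B,τ'}(A_∞, ℂ)) = 1`

Y. Liu, *Fourier–Jacobi cycles and arithmetic relative trace formula*, Camb. J. Math. **9** (2021) 1–147 = arXiv:2102.11518
[Liu2021]; TeX source `FJcycle.tex` (md5 `6db49a74122d2cb0f224fa1b39488a0c`; `l. NNNN` = its lines), §4.2, Proposition 4.13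
(`pr:endoscopy_general`, ll. 2113–2119) and its proof (ll. 2121–2146).  Companion of `Prop413AsPrinted` (same carriers
`Prop413Data`, nothing new posited): the cells' bridge «[Liu2021] Thm. 4.18 AS PRINTED ⟹ combined reading `Thm418C`»
(pub-hodgecm2 HM-EQUALITY Δ2; tree `Liu2021/Thm418CombinedReading.lean`) consumes Step 1 «block ≤ range of the proof map (4.3)»
through the tree theorem `Literature.RepresentationTheory.Liu2021.iSup_iSup_range_le_range_of_rank_hom_le_one`, whose input
`hmult : Module.rank ℂ (ω →ₗ[ℂ[G]] H) ≤ 1` is the printed MULTIPLICITY-ONE sentence below.  The tree so far has that sentence only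
in COUNT form over bare carriers (`Literature.AlgebraicGeometry.Liu2021.LiuAlbaneseDatum.MultOne`, `AlbaneseMultiplicityOne.lean`),
which cannot be instantiated at the `Representation`-valued carriers of `Prop413Data` / `Thm418Data`; this file is the MODULE form
(b01-idea-1's Δ2 input ledger, item (M1), HOME/INBOX l. 5178 / l. 5272).

AS PRINTED, VERBATIM (proof of Prop. 4.13, last sentences, l. 2145–2146): «To summarize, we have shown that if an irreducible
admissible representation `π` of `G(𝔸)` contributes to the Albanese, then `π^∞ ≃ ω(μ,ε,χ)` for a unique adèlic oscillator triple in
which `μ` is of weight one and `ε` is `μ`-admissible, and `m_disc(π) = 1`. Conversely, for every such adèlic oscillator triple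
`(μ,ε,χ)`, there exists a pair `(W, π_W)`, unique up to isomorphism, such that if we denote by `π` an irreducible subrepresentation of
`Θ^V_{(μ,ν),W}(π_W)`, then `ω(μ,ε,χ)` is isomorphic to `π^∞` and `H¹(𝔤, K_G; π_∞) ≠ {0}`. Moreover, by the Rallis inner product
formula, `Θ^V_{(μ,ν),W}(π_W)` is contained in `L²_disc(G)`. Thus, we may apply the above discussions to the representation `π` to
conclude that the dimension of `H¹_{B,τ'}(A_∞, ℂ)[ω(μ,ε,χ)]` is `1`. The proposition follows.»  Used verbatim at ll. 2163–2166: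
«Suppose that `n ≥ 3` and consider an adèlic oscillator triple `(μ,ε,χ)` in which `μ` is of weight one and `ε` is `μ`-admissible.
Then `Hom_{ℚ_ℓ^ac[𝔾(𝔸_F^∞)]}(ι_ℓ ∘ ω(μ,ε,χ), H¹_ét(A_∞ ⊗_{E,τ'} ℂ, ℚ_ℓ^ac))` is a representation of `Gal(ℂ/τ'(E))` over `ℚ_ℓ^ac`. By
Proposition 4.13, such representation is an `ℓ`-adic character».

TYPING (READING M, the only interpretive choice, = the reading of record of `LiuAlbaneseDatum.MultOne`): `H[ω]` is the
`ω`-MULTIPLICITY SPACE `Hom_{ℂ[𝔾(𝔸_F^∞)]}(ω(μ,ε,χ), H¹_{B,τ'}(A_∞, ℂ))` (the object of ll. 2163–2166, with `ℚ_ℓ^ac` for `ℂ`), and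
«the dimension … is `1`» = its `ℂ`-rank is `1`; the `ℂ[𝔾(𝔸_F^∞)]`-linear maps are typed as Mathlib's bundled intertwining maps
`Representation.IntertwiningMap (P.rhoAt t) (P.rhoB τ')` (= `ℂ[G]`-linear maps of the `asModule`s by Mathlib's
`Representation.IntertwiningMap.equivLinearMapAsModule`, recorded below).  Hypotheses as printed: «Suppose that `n ≥ 3`» (the
proposition's, l. 2114) as the antecedent `3 ≤ P.n →`; «for every embedding `τ' : E → ℂ`» (l. 2114 — the proof fixes an arbitrary
`τ'`, l. 2122); the triple ranges over the admissible weight-one triples `P.AdmTriple` (l. 2118 / l. 2145).  Nothing else; no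
condition on `[F:ℚ]`, Galois, signature or compactness (Noncompact and Compact Case alike).  A consumer takes
`(h : P.MultOneAsPrinted)` for ITS OWN `P`; `∀ P, MultOneAsPrinted P` is not the sentence and is not claimed (it is false on
degenerate carriers).  NO PROOF (Track 2).  NOT here: Prop. 4.13 itself (`Prop413AsPrinted`), Remark 4.14 ([GR91, Rog92] for
`n = 3`), the proof's theta-lifting / [BMM] / Rallis steps.

Seat prover-pub-hodgecm2-tr-prover-6-g3-0 (item-(vi) END-display lineage), 2026-08-21.  One `def … : Prop` (the record) + theorems;
no instance, nothing asserted.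

## References
* [Liu2021] §4.2: Prop. 4.13 (ll. 2113–2119) with its proof (ll. 2121–2146, the sentence at l. 2145); ll. 2163–2166; Def. 4.11
  (ll. 2083–2097); Thm. 4.18 (ll. 2232–2245).
* Tree: `Liu2021.Prop413AsPrinted`, `Liu2021.Thm418AsPrinted`, `Liu2021.Thm418CombinedReading` (this directory);
  `Literature.RepresentationTheory.Liu2021.iSup_iSup_range_le_range_of_rank_hom_le_one` / `combinedReading_of_rank_hom_le_one`
  (`RepresentationTheory/Liu2021/AlbaneseBlockMultiplicityOne.lean`); COUNT form `Literature.AlgebraicGeometry.Liu2021.LiuAlbaneseDatum.MultOne`.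
-/

noncomputable section

open NumberField

namespace Literature.NumberTheory.Automorphic.Liu2021

namespace Prop413Data

variable {F E : Type} [Field F] [NumberField F] [IsTotallyReal F] [Field E] [NumberField E] [Algebra F E]
  [IsTotallyComplex E] [Algebra.IsQuadraticExtension F E]

/-- **[Liu2021, proof of Prop. 4.13, last sentence (l. 2145)] AS PRINTED, MODULE form** — «Thus, we may apply the above
discussions to the representation `π` to conclude that the dimension of `H¹_{B,τ'}(A_∞, ℂ)[ω(μ,ε,χ)]` is `1`.» (for every
embedding `τ'`, l. 2114/2122, and every adèlic oscillator triple `(μ,ε,χ)` with `μ` of weight one and `ε` `μ`-admissible,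
l. 2118/2145; under «Suppose that `n ≥ 3`», l. 2114; used verbatim ll. 2163–2166: «`Hom_{ℚ_ℓ^ac[𝔾(𝔸_F^∞)]}(ι_ℓ ∘ ω(μ,ε,χ), H¹_ét(…))`
… By Proposition 4.13, such representation is an `ℓ`-adic character»).  TYPED (READING M): the `ℂ`-rank of the multiplicity space
`Hom_{ℂ[𝔾(𝔸_F^∞)]}(ω_t, H¹_{B,τ'}(A_∞, ℂ))` — Mathlib's bundled intertwining maps `Representation.IntertwiningMap (P.rhoAt t) (P.rhoB τ')`
— is `1`, for every `τ' : E →+* ℂ` and every admissible weight-one triple `t : P.AdmTriple`, provided `3 ≤ P.n`.  (Within the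
proof, «`≥ 1`» is the converse existence clause of l. 2145 and «`≤ 1`» the uniqueness of the triple + `m_disc(π) = 1`; read against
the statement of Prop. 4.13 — each admissible weight-one triple indexing ONE summand — «`= 1`» also leans on the summands being
irreducible and pairwise non-isomorphic, Def. 4.11 / Thm. 4.18 (2) / App. D Lem. D.1 (3), Schur; consumers here use only «`≤ 1`»,
`MultOneAsPrinted.rank_intertwiningMap_le_one`.)  A predicate on the consumer's datum `P`; nothing asserted; NO PROOF.
[cite: Liu2021, Prop. 4.13, proof l. 2145 (multiplicity one); §4.2 ll. 2163–2166] -/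
def MultOneAsPrinted (P : Prop413Data F E) : Prop :=
  3 ≤ P.n → ∀ (τ' : E →+* ℂ) (t : P.AdmTriple),
    Module.rank ℂ (Representation.IntertwiningMap (P.rhoAt t) (P.rhoB τ')) = 1

variable {P : Prop413Data F E}

/-- The rank bound `≤ 1` on the multiplicity space `Hom_{ℂ[G]}(ω_t, H¹_{B,τ'}(A_∞, ℂ))` (bundled intertwining maps), from the
printed «dimension … is `1`». [cite: Liu2021, Prop. 4.13, proof l. 2145] -/
theorem MultOneAsPrinted.rank_intertwiningMap_le_one (h : P.MultOneAsPrinted) (hn : 3 ≤ P.n) (τ' : E →+* ℂ)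
    (t : P.AdmTriple) : Module.rank ℂ (Representation.IntertwiningMap (P.rhoAt t) (P.rhoB τ')) ≤ 1 :=
  (h hn τ' t).le

/-- **Consumer glue, `ℂ[G]`-module currency.**  Mathlib's `Representation.IntertwiningMap.equivLinearMapAsModule` identifies the
bundled intertwining maps `ω_t → H¹_{B,τ'}` with the `ℂ[𝔾(𝔸_F^∞)]`-linear maps between the `asModule`s, `ℂ`-linearly; hence the
printed multiplicity one gives `Module.rank ℂ ((P.rhoAt t).asModule →ₗ[ℂ[G]] (P.rhoB τ').asModule) = 1` — the shape of the
hypothesis `hmult` of the tree's `Literature.RepresentationTheory.Liu2021.combinedReading_of_rank_hom_le_one` /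
`iSup_iSup_range_le_range_of_rank_hom_le_one` at `k := ℂ`, `R := MonoidAlgebra ℂ P.G`. [cite: Liu2021, Prop. 4.13, proof l. 2145] -/
theorem MultOneAsPrinted.rank_linearMap_asModule_eq_one (h : P.MultOneAsPrinted) (hn : 3 ≤ P.n) (τ' : E →+* ℂ)
    (t : P.AdmTriple) :
    Module.rank ℂ ((P.rhoAt t).asModule →ₗ[MonoidAlgebra ℂ P.G] (P.rhoB τ').asModule) = 1 := by
  rw [← (Representation.IntertwiningMap.equivLinearMapAsModule (P.rhoAt t) (P.rhoB τ')).rank_eq]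
  exact h hn τ' t

/-- The `≤ 1` form in `ℂ[G]`-module currency (exactly the binder `hmult` of `combinedReading_of_rank_hom_le_one`, per summand).
[cite: Liu2021, Prop. 4.13, proof l. 2145] -/
theorem MultOneAsPrinted.rank_linearMap_asModule_le_one (h : P.MultOneAsPrinted) (hn : 3 ≤ P.n) (τ' : E →+* ℂ)
    (t : P.AdmTriple) :
    Module.rank ℂ ((P.rhoAt t).asModule →ₗ[MonoidAlgebra ℂ P.G] (P.rhoB τ').asModule) ≤ 1 :=
  (h.rank_linearMap_asModule_eq_one hn τ' t).le

/-- **At Thm. 4.18's datum over the same carriers** (`P.toThm418Data R`, one weight-one `μ`): the multiplicity space of the summand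
`ω_{(ε,χ)}` of Thm. 4.18 — which IS `ω_{(μ,ε,χ)}` of Prop. 4.13 (`omegaAt_toThm418Data`, `admTripleOf`) — in `H¹_{B,τ'}(A_∞, ℂ)` has
`ℂ`-rank `≤ 1`. [cite: Liu2021, Prop. 4.13, proof l. 2145; Thm. 4.18] -/
theorem MultOneAsPrinted.rank_intertwiningMap_toThm418Data_le_one (h : P.MultOneAsPrinted) (hn : 3 ≤ P.n)
    {μ : IdeleClassGroup E →ₜ* Circle} (R : P.Rest418 μ) (τ' : E →+* ℂ) (i : (P.toThm418Data R).AdmIndex) :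
    Module.rank ℂ (Representation.IntertwiningMap ((P.toThm418Data R).rhoAt i) (P.rhoB τ')) ≤ 1 :=
  h.rank_intertwiningMap_le_one hn τ' (P.admTripleOf R i)

/-- **Every intertwiner is a multiple of a given non-zero one** (the form in which Step 1 of the combined reading uses l. 2145):
under the printed multiplicity one, if `j : ω_t → H¹_{B,τ'}` is a non-zero intertwining map then every intertwining map
`ψ : ω_t → H¹_{B,τ'}` is `c • j` for some `c : ℂ`. [cite: Liu2021, Prop. 4.13, proof l. 2145] -/
theorem MultOneAsPrinted.exists_eq_smul (h : P.MultOneAsPrinted) (hn : 3 ≤ P.n) (τ' : E →+* ℂ) (t : P.AdmTriple)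
    {j : Representation.IntertwiningMap (P.rhoAt t) (P.rhoB τ')} (hj : j ≠ 0)
    (ψ : Representation.IntertwiningMap (P.rhoAt t) (P.rhoB τ')) : ∃ c : ℂ, ψ = c • j := by
  obtain ⟨v₀, hv₀⟩ := rank_le_one_iff.mp (h.rank_intertwiningMap_le_one hn τ' t)
  obtain ⟨r, hr⟩ := hv₀ j
  obtain ⟨s, hs⟩ := hv₀ ψ
  have hr0 : r ≠ 0 := by
    rintro rfl
    exact hj (by rw [← hr, zero_smul])
  refine ⟨s * r⁻¹, ?_⟩
  rw [← hs, ← hr, smul_smul, mul_assoc, inv_mul_cancel₀ hr0, mul_one]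

/-- **The record is satisfiable** (hypothesis non-vacuity, not a statement about Liu's objects): at the trivial datum of
`Prop413Data.nonempty` (`n := 2`) the record holds vacuously (its antecedent `3 ≤ n` fails) — a consumer's `P` has its own `n`.
Our bookkeeping. [cite: Liu2021, §4.2 l. 2053] -/
theorem multOneAsPrinted_satisfiable (F E : Type) [Field F] [NumberField F] [IsTotallyReal F] [Field E] [NumberField E]
    [Algebra F E] [IsTotallyComplex E] [Algebra.IsQuadraticExtension F E] :
    ∃ P : Prop413Data F E, P.MultOneAsPrinted :=
  ⟨⟨2, le_rfl, PUnit, PUnit, PUnit, fun _ => PUnit.unit, PUnit, fun _ _ _ _ => PUnit, fun _ _ _ _ => 1, fun _ => PUnit,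
    fun _ => 1⟩, fun h => absurd h (by norm_num)⟩

end Prop413Data

end Literature.NumberTheory.Automorphic.Liu2021

end
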